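import Mathlib
import HarnessLib
import Summits.KontsevichZagierPeriods.Zeta5Search.Denom.TwoTaleL25Exponent

/-!
# TwoTaleL25Levels — prime-by-prime API of the L(2/5) saving product `Φₙ` and the bridge from level divisibilities to `InclusionL25`

HONEST FRAMING: systematic search; no irrationality claim unless certified.

Cell pub-zeta5 (measure-opt g0), rung L(2/5) of the two-tale ladder; the L(2/5) clone of fam-denom's `TwoTaleL25Levels`
(all PROVED, no inputs; `p`-adic bookkeeping only).
`TwoTaleL25Saving.savingProductL25 n = ∏_{i<54} ∏ {p ∈ classPrimes 6400 (37·) (ivlL25 i) n}` counts a prime `p`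
(`6400 n < p²`, `p ≤ 37n`) once for every interval `ivlL25 i` containing `{n/p}`; `ivlL25 0 … ivlL25 25` are the LEVEL-1
components of `{ν ≥ 1}` and `ivlL25 26 … ivlL25 53` the LEVEL-2 components of `{ν = 2}` (`ν = max(φ, φ̂)`).

* `mem_classPrimes_ivlL25_iff` — `p` is counted in interval `i` iff `p` prime, `p ≤ 37n`, `6400 n < p²`, `uᵢ ≤ {n/p} < vᵢ`;
* `ivlMultL25 n p = #{i < 54 : p counted in i}`, **`factorization_savingProductL25`**, `savingProductL25_dvd_iff`,
  `savingProductL25_dvd_int_of_prime_pow_dvd`;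
* `lvl1_sep` / `lvl2_sep` — the intervals of one level are ordered (consecutive steps `lvl1_step` / `lvl2_step` +
  induction), hence pairwise disjoint, so `ivlMultL25 n p ≤ 2`;
* **`prime_pow_ivlMultL25_dvd_of_levels`**, **`savingProductL25_dvd_of_levels`**, `savingProductL25_dvd_of_unpacked`
  (level-1 divisibilities `p ∣ M` and level-2 divisibilities `p² ∣ M` give `Φₙ ∣ M`);
* **`inclusionL25_of_levels`**: the same for `M = qₙ` and for an integer `Z = D₃₇ₙD₃₉ₙ pₙ` prove
  `TwoTaleL25Exponent.InclusionL25`.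
The per-interval divisibilities themselves come from the digit tables (`Denom.DigitCover`,
`Denom.TwoTaleL25DigitTables`) in `Denom.TwoTaleL25Inclusion`.
-/

noncomputable section

open Finset
open Literature.NumberTheory.DiophantineApproximation.RhinViola
open Summit.KontsevichZagierPeriods.Zeta5Search.Denom.TwoTaleL25Saving
open Summit.KontsevichZagierPeriods.Zeta5Search.Denom.TwoTaleL25Forms
open Summit.KontsevichZagierPeriods.Zeta5Search.Denom.TwoTaleL25Exponent

namespace Summit.KontsevichZagierPeriods.Zeta5Search.Denom.TwoTaleL25Levels

/-! ### Membership and the plain product -/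

/-- A prime `p` is counted in the digit interval `ivlL25 i = [uᵢ, vᵢ)` at `n` iff `p ≤ 37n`, `6400 n < p²` and
`uᵢ ≤ {n/p} < vᵢ`. -/
theorem mem_classPrimes_ivlL25_iff {i n p : ℕ} :
    p ∈ classPrimes 6400 primeCutL25 (ivlL25 i) n ↔
      p.Prime ∧ p ≤ 37 * n ∧ (6400 : ℝ) * n < (p : ℝ) ^ 2 ∧
        (ivlL25 i).1 ≤ Int.fract ((n : ℝ) / p) ∧ Int.fract ((n : ℝ) / p) < (ivlL25 i).2 := by
  simp only [classPrimes, primeCutL25, mem_filter, mem_range]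
  constructor
  · rintro ⟨h1, h2, h3, h4, h5⟩
    exact ⟨h2, by omega, h3, h4, h5⟩
  · rintro ⟨h2, h1, h3, h4, h5⟩
    exact ⟨by omega, h2, h3, h4, h5⟩

/-- `6400 n < p²` over `ℝ` iff over `ℕ`. -/
theorem cast_lt_sq_iff {n p : ℕ} : (6400 : ℝ) * n < (p : ℝ) ^ 2 ↔ 6400 * n < p ^ 2 := by
  constructor
  · intro h; exact_mod_cast h
  · intro h; exact_mod_cast h

/-- A counted prime satisfies the hypotheses of the per-interval divisibility theorems. -/
theorem hyps_of_mem_classPrimes_ivlL25 {i n p : ℕ} (h : p ∈ classPrimes 6400 primeCutL25 (ivlL25 i) n) :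
    p.Prime ∧ p ≤ 37 * n ∧ 6400 * n < p ^ 2 ∧
      (ivlL25 i).1 ≤ Int.fract ((n : ℝ) / p) ∧ Int.fract ((n : ℝ) / p) < (ivlL25 i).2 := by
  obtain ⟨hp, hle, h2, h3, h4⟩ := mem_classPrimes_ivlL25_iff.1 h
  exact ⟨hp, hle, cast_lt_sq_iff.1 h2, h3, h4⟩

/-- `ivlProductL25 i n` is the plain product of the primes of class `i`. -/
theorem ivlProductL25_eq (i n : ℕ) : ivlProductL25 i n = ∏ p ∈ classPrimes 6400 primeCutL25 (ivlL25 i) n, p := by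
  simp [ivlProductL25, classPrimeProduct, Finset.singleton_biUnion]

/-- **Multiplicity of `p` in `Φₙ`**: the number of the 54 digit intervals whose class contains `p`
(`= ν(n/p)` for a prime `p ≤ 37n`, `p² > 6400 n`; `0` otherwise). -/
def ivlMultL25 (n p : ℕ) : ℕ := ((range 54).filter fun i => p ∈ classPrimes 6400 primeCutL25 (ivlL25 i) n).card

/-- A non-prime has multiplicity `0`. -/
theorem ivlMultL25_eq_zero_of_not_prime {n p : ℕ} (hp : ¬ p.Prime) : ivlMultL25 n p = 0 := by
  rw [ivlMultL25, card_eq_zero, filter_eq_empty_iff]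
  intro i _ h
  exact hp (prime_of_mem_classPrimes h)

/-! ### Factorization of `Φₙ` -/

/-- `v_p` of one class product: `1` if `p` is in the class, else `0`. -/
theorem factorization_ivlProductL25 (i n p : ℕ) :
    (ivlProductL25 i n).factorization p = if p ∈ classPrimes 6400 primeCutL25 (ivlL25 i) n then 1 else 0 := by
  rw [ivlProductL25_eq, Nat.factorization_prod fun q hq => (prime_of_mem_classPrimes hq).ne_zero,
    Finsupp.finsetSum_apply]
  have h : ∀ q ∈ classPrimes 6400 primeCutL25 (ivlL25 i) n, q.factorization p = if q = p then 1 else 0 :=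
    fun q hq => by rw [(prime_of_mem_classPrimes hq).factorization, Finsupp.single_apply]
  rw [sum_congr rfl h, sum_ite_eq']

/-- **`(Φₙ).factorization p = ivlMultL25 n p`.** -/
theorem factorization_savingProductL25 (n p : ℕ) : (savingProductL25 n).factorization p = ivlMultL25 n p := by
  rw [savingProductL25, Nat.factorization_prod fun i _ => (ivlProductL25_pos i n).ne', Finsupp.finsetSum_apply]
  simp_rw [factorization_ivlProductL25]
  rw [ivlMultL25, card_filter]

/-- `v_p(Φₙ) = ivlMultL25 n p` for a prime `p`. -/
theorem padicValNat_savingProductL25 {n p : ℕ} (hp : p.Prime) :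
    padicValNat p (savingProductL25 n) = ivlMultL25 n p := by
  rw [← Nat.factorization_def _ hp, factorization_savingProductL25]

/-! ### Divisibility criteria -/

/-- **`Φₙ ∣ M ↔ ∀ p prime, ivlMultL25 n p ≤ v_p(M)`** (`M ≠ 0`). -/
theorem savingProductL25_dvd_iff {n M : ℕ} (hM : M ≠ 0) :
    savingProductL25 n ∣ M ↔ ∀ p : ℕ, p.Prime → ivlMultL25 n p ≤ padicValNat p M := by
  rw [← Nat.factorization_le_iff_dvd (savingProductL25_pos n).ne' hM, Finsupp.le_def]
  constructor
  · intro h p hp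
    have h' := h p
    rwa [factorization_savingProductL25, Nat.factorization_def _ hp] at h'
  · intro h p
    by_cases hp : p.Prime
    · rw [factorization_savingProductL25, Nat.factorization_def _ hp]; exact h p hp
    · rw [Nat.factorization_eq_zero_of_not_prime _ hp]; exact Nat.zero_le _

/-- The same over `ℤ`: `Φₙ ∣ z ↔ ∀ p prime, ivlMultL25 n p ≤ v_p(z)` (`z ≠ 0`). -/
theorem savingProductL25_dvd_int_iff {n : ℕ} {z : ℤ} (hz : z ≠ 0) :
    (savingProductL25 n : ℤ) ∣ z ↔ ∀ p : ℕ, p.Prime → ivlMultL25 n p ≤ padicValInt p z := by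
  rw [Int.natCast_dvd, savingProductL25_dvd_iff (Int.natAbs_ne_zero.2 hz)]
  simp only [padicValInt]

/-- **Prime powers suffice:** if `p ^ ivlMultL25 n p ∣ z` for every prime `p`, then `Φₙ ∣ z`. -/
theorem savingProductL25_dvd_int_of_prime_pow_dvd {n : ℕ} {z : ℤ}
    (h : ∀ p : ℕ, p.Prime → (p : ℤ) ^ ivlMultL25 n p ∣ z) : (savingProductL25 n : ℤ) ∣ z := by
  rcases eq_or_ne z 0 with rfl | hz
  · exact dvd_zero _
  rw [savingProductL25_dvd_int_iff hz]
  intro p hp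
  haveI := Fact.mk hp
  exact ((padicValInt_dvd_iff _ _).1 (h p hp)).resolve_left hz

/-! ### The intervals of one level are pairwise disjoint -/

/-- Consecutive level-1 intervals are ordered: `vⱼ ≤ uⱼ₊₁` for `j + 1 < 26`. -/
theorem lvl1_step (j : ℕ) (hj : j + 1 < 26) : (ivlL25 j).2 ≤ (ivlL25 (j + 1)).1 := by
  have hj' : j < 25 := by omega
  interval_cases j <;> norm_num [ivlL25]

/-- Consecutive level-2 intervals are ordered: `vⱼ ≤ uⱼ₊₁` for `26 ≤ j`, `j + 1 < 54`. -/
theorem lvl2_step (j : ℕ) (hj : 26 ≤ j) (hj' : j + 1 < 54) : (ivlL25 j).2 ≤ (ivlL25 (j + 1)).1 := by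
  have hj'' : j < 53 := by omega
  interval_cases j <;> norm_num [ivlL25]

/-- Ordered separation of the level-1 intervals: `vᵢ ≤ uⱼ` for `i < j < 26`. -/
theorem lvl1_sep {i j : ℕ} (hij : i < j) (hj : j < 26) : (ivlL25 i).2 ≤ (ivlL25 j).1 := by
  induction j with
  | zero => omega
  | succ k ih =>
    rcases Nat.lt_succ_iff_lt_or_eq.1 hij with h | h
    · exact (ih h (by omega)).trans (((ivlL25_lt k).le).trans (lvl1_step k hj))
    · subst h; exact lvl1_step i hj

/-- Ordered separation of the level-2 intervals: `vᵢ ≤ uⱼ` for `26 ≤ i < j < 54`. -/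
theorem lvl2_sep {i j : ℕ} (hi : 26 ≤ i) (hij : i < j) (hj : j < 54) : (ivlL25 i).2 ≤ (ivlL25 j).1 := by
  induction j with
  | zero => omega
  | succ k ih =>
    rcases Nat.lt_succ_iff_lt_or_eq.1 hij with h | h
    · exact (ih h (by omega)).trans (((ivlL25_lt k).le).trans (lvl2_step k (by omega) hj))
    · subst h; exact lvl2_step i hi hj

/-- The 26 level-1 intervals `ivlL25 0, …, ivlL25 25` are pairwise disjoint. -/
theorem lvl1_unique {x : ℝ} {i j : ℕ} (hi : i < 26) (hj : j < 26)
    (h1 : (ivlL25 i).1 ≤ x) (h2 : x < (ivlL25 i).2) (h3 : (ivlL25 j).1 ≤ x) (h4 : x < (ivlL25 j).2) : i = j := by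
  by_contra hne
  rcases Nat.lt_or_gt_of_ne hne with h | h
  · have := lvl1_sep h hj; linarith
  · have := lvl1_sep h hi; linarith

/-- The 28 level-2 intervals `ivlL25 26, …, ivlL25 53` are pairwise disjoint. -/
theorem lvl2_unique {x : ℝ} {i j : ℕ} (hi : 26 ≤ i) (hi' : i < 54) (hj : 26 ≤ j) (hj' : j < 54)
    (h1 : (ivlL25 i).1 ≤ x) (h2 : x < (ivlL25 i).2) (h3 : (ivlL25 j).1 ≤ x) (h4 : x < (ivlL25 j).2) : i = j := by
  by_contra hne
  rcases Nat.lt_or_gt_of_ne hne with h | h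
  · have := lvl2_sep hi h hj'; linarith
  · have := lvl2_sep hj h hi'; linarith

/-- At most one level-1 interval counts a given `p`. -/
theorem card_filter_lvl1_le_one (n p : ℕ) :
    ((Ico 0 26).filter fun i => p ∈ classPrimes 6400 primeCutL25 (ivlL25 i) n).card ≤ 1 := by
  refine card_le_one.2 fun i hi j hj => ?_
  simp only [mem_filter, mem_Ico] at hi hj
  obtain ⟨-, -, -, a1, a2⟩ := hyps_of_mem_classPrimes_ivlL25 hi.2
  obtain ⟨-, -, -, b1, b2⟩ := hyps_of_mem_classPrimes_ivlL25 hj.2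
  exact lvl1_unique hi.1.2 hj.1.2 a1 a2 b1 b2

/-- At most one level-2 interval counts a given `p`. -/
theorem card_filter_lvl2_le_one (n p : ℕ) :
    ((Ico 26 54).filter fun i => p ∈ classPrimes 6400 primeCutL25 (ivlL25 i) n).card ≤ 1 := by
  refine card_le_one.2 fun i hi j hj => ?_
  simp only [mem_filter, mem_Ico] at hi hj
  obtain ⟨-, -, -, a1, a2⟩ := hyps_of_mem_classPrimes_ivlL25 hi.2
  obtain ⟨-, -, -, b1, b2⟩ := hyps_of_mem_classPrimes_ivlL25 hj.2
  exact lvl2_unique hi.1.1 hi.1.2 hj.1.1 hj.1.2 a1 a2 b1 b2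

/-- `ivlMultL25` splits into its level-1 and level-2 counts. -/
theorem ivlMultL25_eq_add (n p : ℕ) :
    ivlMultL25 n p = ((Ico 0 26).filter fun i => p ∈ classPrimes 6400 primeCutL25 (ivlL25 i) n).card +
      ((Ico 26 54).filter fun i => p ∈ classPrimes 6400 primeCutL25 (ivlL25 i) n).card := by
  have h : range 54 = Ico 0 26 ∪ Ico 26 54 := by
    rw [range_eq_Ico, Ico_union_Ico_eq_Ico (by norm_num) (by norm_num)]
  unfold ivlMultL25
  rw [h, filter_union, card_union_of_disjoint]
  exact disjoint_filter_filter (Ico_disjoint_Ico_consecutive 0 26 54)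

/-- `ν ≤ 2`: every prime is counted at most twice. -/
theorem ivlMultL25_le_two (n p : ℕ) : ivlMultL25 n p ≤ 2 := by
  rw [ivlMultL25_eq_add]
  have := card_filter_lvl1_le_one n p
  have := card_filter_lvl2_le_one n p
  omega

/-! ### From level divisibilities to `Φₙ ∣ M` -/

/-- **Level divisibilities give `p ^ ivlMultL25 n p ∣ M`.**  If `p ∣ M` whenever `p` is counted in a level-1 interval
and `p² ∣ M` whenever `p` is counted in a level-2 interval, then `p ^ ivlMultL25 n p ∣ M`. -/
theorem prime_pow_ivlMultL25_dvd_of_levels {n : ℕ} {M : ℤ}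
    (h1 : ∀ i < 26, ∀ p ∈ classPrimes 6400 primeCutL25 (ivlL25 i) n, (p : ℤ) ∣ M)
    (h2 : ∀ i, 26 ≤ i → i < 54 → ∀ p ∈ classPrimes 6400 primeCutL25 (ivlL25 i) n, (p : ℤ) ^ 2 ∣ M)
    (p : ℕ) : (p : ℤ) ^ ivlMultL25 n p ∣ M := by
  have c1 := card_filter_lvl1_le_one n p
  rw [ivlMultL25_eq_add]
  rcases ((Ico 26 54).filter fun i => p ∈ classPrimes 6400 primeCutL25 (ivlL25 i) n).eq_empty_or_nonempty
    with hS | ⟨i, hi⟩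
  · rw [hS, card_empty, add_zero]
    rcases ((Ico 0 26).filter fun i => p ∈ classPrimes 6400 primeCutL25 (ivlL25 i) n).eq_empty_or_nonempty
      with hT | ⟨j, hj⟩
    · rw [hT, card_empty, pow_zero]; exact one_dvd _
    · rw [le_antisymm c1 (card_pos.2 ⟨j, hj⟩), pow_one]
      simp only [mem_filter, mem_Ico] at hj
      exact h1 j hj.1.2 p hj.2
  · have hp2 : (p : ℤ) ^ 2 ∣ M := by
      simp only [mem_filter, mem_Ico] at hi
      exact h2 i hi.1.1 hi.1.2 p hi.2
    refine (pow_dvd_pow _ ?_).trans hp2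
    have := ivlMultL25_le_two n p
    rw [ivlMultL25_eq_add] at this
    exact this

/-- **`Φₙ ∣ M` from level divisibilities.** -/
theorem savingProductL25_dvd_of_levels {n : ℕ} {M : ℤ}
    (h1 : ∀ i < 26, ∀ p ∈ classPrimes 6400 primeCutL25 (ivlL25 i) n, (p : ℤ) ∣ M)
    (h2 : ∀ i, 26 ≤ i → i < 54 → ∀ p ∈ classPrimes 6400 primeCutL25 (ivlL25 i) n, (p : ℤ) ^ 2 ∣ M) :
    (savingProductL25 n : ℤ) ∣ M :=
  savingProductL25_dvd_int_of_prime_pow_dvd fun p _ => prime_pow_ivlMultL25_dvd_of_levels h1 h2 p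

/-- Variant with the level divisibilities stated through the unpacked hypotheses (`p` prime, `p ≤ 37n`,
`6400 n < p²`, `uᵢ ≤ {n/p} < vᵢ`), the shape delivered by the digit tables (`Denom.DigitCover.dvd_of_cover`). -/
theorem savingProductL25_dvd_of_unpacked {n : ℕ} {M : ℤ}
    (h1 : ∀ i < 26, ∀ p : ℕ, p.Prime → p ≤ 37 * n → 6400 * n < p ^ 2 →
      (ivlL25 i).1 ≤ Int.fract ((n : ℝ) / p) → Int.fract ((n : ℝ) / p) < (ivlL25 i).2 → (p : ℤ) ∣ M)
    (h2 : ∀ i, 26 ≤ i → i < 54 → ∀ p : ℕ, p.Prime → p ≤ 37 * n → 6400 * n < p ^ 2 →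
      (ivlL25 i).1 ≤ Int.fract ((n : ℝ) / p) → Int.fract ((n : ℝ) / p) < (ivlL25 i).2 → (p : ℤ) ^ 2 ∣ M) :
    (savingProductL25 n : ℤ) ∣ M := by
  refine savingProductL25_dvd_of_levels (fun i hi p hp => ?_) fun i hi hi' p hp => ?_
  · obtain ⟨a, b, c, d, e⟩ := hyps_of_mem_classPrimes_ivlL25 hp
    exact h1 i hi p a b c d e
  · obtain ⟨a, b, c, d, e⟩ := hyps_of_mem_classPrimes_ivlL25 hp
    exact h2 i hi hi' p a b c d e

/-! ### The `InclusionL25` input from per-interval theorems -/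

/-- **Bridge.** Prime-power divisibility for the `q`-side and an integer witness for the `p`-side give `InclusionL25`. -/
theorem inclusionL25_of_dvd
    (hq : ∀ n : ℕ, 1 ≤ n → ∀ p : ℕ, p.Prime → (p : ℤ) ^ ivlMultL25 n p ∣ ((lcmNormaliserL25 n : ℕ) : ℤ) * formQL25 n)
    (hp : ∀ n : ℕ, 1 ≤ n → ∃ A : ℤ, ((lcmNormaliserL25 n : ℕ) : ℚ) * formPL25 n = (savingProductL25 n : ℚ) * A) :
    InclusionL25 := fun n hn =>
  ⟨by obtain ⟨B, hB⟩ := savingProductL25_dvd_int_of_prime_pow_dvd (hq n hn); exact ⟨B, hB⟩, hp n hn⟩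

/-- **`InclusionL25` from unpacked level divisibilities of `qₙ` and of an integer `Z = D₃₇ₙD₃₉ₙ pₙ`** (all `n ≥ 1`):
`Φₙ ∣ D₃₇ₙD₃₉ₙ qₙ` and `Φₙ⁻¹ D₃₇ₙD₃₉ₙ pₙ ∈ ℤ`. -/
theorem inclusionL25_of_unpacked
    (hq : ∀ n, 1 ≤ n →
      (∀ i < 26, ∀ p : ℕ, p.Prime → p ≤ 37 * n → 6400 * n < p ^ 2 →
        (ivlL25 i).1 ≤ Int.fract ((n : ℝ) / p) → Int.fract ((n : ℝ) / p) < (ivlL25 i).2 → (p : ℤ) ∣ formQL25 n) ∧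
      (∀ i, 26 ≤ i → i < 54 → ∀ p : ℕ, p.Prime → p ≤ 37 * n → 6400 * n < p ^ 2 →
        (ivlL25 i).1 ≤ Int.fract ((n : ℝ) / p) → Int.fract ((n : ℝ) / p) < (ivlL25 i).2 → (p : ℤ) ^ 2 ∣ formQL25 n))
    (hp : ∀ n, 1 ≤ n → ∃ Z : ℤ, ((lcmNormaliserL25 n : ℕ) : ℚ) * formPL25 n = Z ∧
      (∀ i < 26, ∀ p : ℕ, p.Prime → p ≤ 37 * n → 6400 * n < p ^ 2 →
        (ivlL25 i).1 ≤ Int.fract ((n : ℝ) / p) → Int.fract ((n : ℝ) / p) < (ivlL25 i).2 → (p : ℤ) ∣ Z) ∧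
      (∀ i, 26 ≤ i → i < 54 → ∀ p : ℕ, p.Prime → p ≤ 37 * n → 6400 * n < p ^ 2 →
        (ivlL25 i).1 ≤ Int.fract ((n : ℝ) / p) → Int.fract ((n : ℝ) / p) < (ivlL25 i).2 → (p : ℤ) ^ 2 ∣ Z)) :
    InclusionL25 := by
  intro n hn
  obtain ⟨hq1, hq2⟩ := hq n hn
  obtain ⟨Z, hZ, hz1, hz2⟩ := hp n hn
  refine ⟨?_, ?_⟩
  · obtain ⟨B, hB⟩ := savingProductL25_dvd_of_unpacked hq1 hq2
    exact ⟨((lcmNormaliserL25 n : ℕ) : ℤ) * B, by rw [hB]; ring⟩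
  · obtain ⟨A, hA⟩ := savingProductL25_dvd_of_unpacked hz1 hz2
    exact ⟨A, by rw [hZ, hA]; push_cast; ring⟩

end Summit.KontsevichZagierPeriods.Zeta5Search.Denom.TwoTaleL25Levels

end
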